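import Summits.AnomalousDissipation.AnomalousDissipation.Theorems.FloorCertificate.Negative.WeakDuality

/-!
# Stub `stub_steadyTaxed` (E) of the line `Sketch`
# (crux stmt-AnomalousDissipation-14086, `TaylorCertificates.FloorCertificateEnsembleCeiling`)

THE TAXED PINCH ON ATOMS. If the energy-taxed floor with constants `(ε₁, κ)` and multiplier
`(Ψ, α)`,
`ε₁ + κ|v|² ≤ ν‖∇v‖² + ⟨F(v), Ψ'(v)⟩ + 2α((v,f) − ν‖∇v‖²)`,
holds at every finite-enstrophy state `v` of the Leray ball `|v|² ≤ 16‖f‖²/ν²` of `(f, ν)`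
(`ν > 0`, `f ∈ L²`), then every steady weak solution `u ∈ V` of `NS_ν(f)` satisfies
`ε₁ + κ|u|² ≤ ν‖∇u‖² = (u, f) ≤ |u| ‖f‖₂`.

Proof (the Dirac case of weak duality, verbatim the landed
`FloorCertificate.Negative.WeakDuality.floorFamily_le_dissipation_of_steady` with the constant budget
`ε₀` replaced by `ε₁ + κ|u|²`): `u ∈ V` has finite enstrophy; the energy equation
`ν‖∇u‖² = (u,f)` (`Torus.IsSteadyWeakSolution.energy_eq'`, Temam 1979 (1.22), proved in tree) with
Cauchy–Schwarz `(u,f) ≤ |u| ‖f‖₂` and Poincaré `4π²|u|² ≤ ‖∇u‖²` puts `u` in the FMRT support ball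
`|u| ≤ ‖f‖₂/(4π²ν)`, hence in the Leray ball (`ball_of_norm_le`); the generator term vanishes at a
steady state because `Ψ'(u)` is a smooth solenoidal mean-zero test field, and the energy channel
`(u,f) − ν‖∇u‖²` vanishes by the energy equation. No sign condition on `α` or `κ` is needed.

References: Temam, *Navier–Stokes Equations* (1979), Ch. II (1.22) (energy equation of steady weak
solutions, `d ≤ 4`); Foias–Manley–Rosa–Temam 2001, Ch. IV Def. 1.3.
-/

set_option linter.dupNamespace false

noncomputable section

namespace Summit.AnomalousDissipation.AnomalousDissipation.Theorems.TaylorCertificatesFloorCertificateEnsembleCeiling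

open MeasureTheory
open scoped ENNReal
open Literature.Analysis.FunctionSpaces Literature.Analysis.FluidPDE
open Summit.AnomalousDissipation.AnomalousDissipation.Theorems.FloorCertificate.Negative

/-- Local notation: real vector fields on `T³`. -/
local notation "Vec3" => (UnitAddTorus (Fin 3)) → (EuclideanSpace ℝ (Fin 3))
/-- Local notation: `L²(T³; ℝ³)`. -/
local notation "L2" => (Lp (EuclideanSpace ℝ (Fin 3)) 2 (volume : Measure (UnitAddTorus (Fin 3))))
/-- Local notation: the energy space `H`. -/
local notation "H3" => (Torus.energySpace (Fin 3))

/-- **E `stub_steadyTaxed`** — THE TAXED PINCH ON ATOMS. If the taxed floor with constants `(ε₁, κ)`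
and multiplier `(Ψ, α)` holds at every finite-enstrophy state of the Leray ball of `(f, ν)` (`ν > 0`,
`f ∈ L²`), then every steady weak solution `u ∈ V` of `NS_ν(f)` satisfies
`ε₁ + κ|u|² ≤ ν‖∇u‖² = (u, f) ≤ |u| ‖f‖₂`: `u ∈ V` has finite enstrophy
(`hV.2.eGradNormSq_lt_top`), the energy equation `ν‖∇u‖² = (u,f)` (`IsSteadyWeakSolution.energy_eq'`,
`Fintype.card (Fin 3) ≤ 4`) + Poincaré (`Torus.norm_sq_le_toReal_eGradNormSq`) put `u` in the ball
(`ball_of_norm_le`), the generator term vanishes at a steady state (`Ψ'(u) ∈ 𝒱`: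
`CylindricalTest.isSmooth_grad_holds` / `isDivFree_grad_holds` / `hasZeroMean_grad_holds`) and so does
the energy channel. No sign condition on `α` or `κ` is needed. -/
theorem stub_steadyTaxed :
    ∀ (ν : ℝ) (f : Vec3) (hf : MemLp f 2 volume) (Ψ : Torus.CylindricalTest (Fin 3)) (α ε₁ κ : ℝ) (u : H3),
      0 < ν →
      (∀ v : H3, Torus.eGradNormSq ((v : L2) : Vec3) ≠ ⊤ → ‖v‖ ^ 2 ≤ 16 * (∫ x, ‖f x‖ ^ 2) / ν ^ 2 →
        ε₁ + κ * ‖v‖ ^ 2 ≤ ν * (Torus.eGradNormSq ((v : L2) : Vec3)).toReal +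
          Torus.nsGeneratorPairing ν f v (Ψ.grad v) +
          2 * α * (Torus.pairing (v : L2) f - ν * (Torus.eGradNormSq ((v : L2) : Vec3)).toReal)) →
      (u : L2) ∈ Torus.energySpaceV (Fin 3) → Torus.IsSteadyWeakSolution ν f u →
      ε₁ + κ * ‖u‖ ^ 2 ≤ ν * (Torus.eGradNormSq ((u : L2) : Vec3)).toReal ∧
        ν * (Torus.eGradNormSq ((u : L2) : Vec3)).toReal = Torus.pairing (u : L2) f ∧
        Torus.pairing (u : L2) f ≤ ‖u‖ * ‖hf.toLp f‖ := by
  intro ν f hf Ψ α ε₁ κ u hν hfloor hV hu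
  -- finite enstrophy of a `V`-element
  have hfin : Torus.eGradNormSq ((u : L2) : Vec3) ≠ ⊤ := hV.2.eGradNormSq_lt_top.ne
  -- the energy equation `ν‖∇u‖² = (u,f)` of a steady weak solution in `V` (dimension `≤ 4`)
  have henergy : ν * (Torus.eGradNormSq ((u : L2) : Vec3)).toReal = Torus.pairing (u : L2) f :=
    Torus.IsSteadyWeakSolution.energy_eq' (by simp) hf hV hu
  -- Cauchy–Schwarz `(u,f) ≤ |u| ‖f‖₂`
  have hp : Torus.pairing (u : L2) f ≤ ‖u‖ * ‖hf.toLp f‖ :=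
    (le_abs_self _).trans (Torus.abs_pairing_coe_le hf u)
  -- the generator term vanishes at a steady state: `Ψ'(u)` is an admissible test field
  have hgen : Torus.nsGeneratorPairing ν f u (Ψ.grad u) = 0 :=
    hu _ (Torus.CylindricalTest.isSmooth_grad_holds Ψ u) (Torus.CylindricalTest.isDivFree_grad_holds Ψ u)
      (Torus.CylindricalTest.hasZeroMean_grad_holds Ψ u)
  -- the Leray ball from the energy equation and Poincaré
  have hball : ‖u‖ ^ 2 ≤ 16 * (∫ x, ‖f x‖ ^ 2) / ν ^ 2 := by
    refine ball_of_norm_le hν hf ?_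
    have hP := Torus.norm_sq_le_toReal_eGradNormSq u hfin
    rw [le_div_iff₀ (by positivity)]
    by_cases h0 : ‖u‖ = 0
    · rw [h0, zero_mul]; exact norm_nonneg _
    · have hpos : 0 < ‖u‖ := lt_of_le_of_ne (norm_nonneg _) (Ne.symm h0)
      have : ν * (4 * Real.pi ^ 2 * ‖u‖ ^ 2) ≤ ‖u‖ * ‖hf.toLp f‖ := by nlinarith
      nlinarith
  -- apply the taxed floor AT `u`: the generator term and the energy channel vanish
  have h := hfloor u hfin hball
  rw [hgen, ← henergy, sub_self, mul_zero, add_zero, add_zero] at h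
  exact ⟨h, henergy, hp⟩

end Summit.AnomalousDissipation.AnomalousDissipation.Theorems.TaylorCertificatesFloorCertificateEnsembleCeiling
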